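import Literature.AnabelianGeometry.SemiGraphs.ProSigmaCuspInertiaFreeCyclic
import Literature.AnabelianGeometry.AbsoluteAnabelian.AbsTopII.DPSCIndexDataOfEmbeddingCuspCyclic
import Literature.AnabelianGeometry.AbsoluteAnabelian.AbsTopII.Prop13SmoothCurveModel
import Literature.AnabelianGeometry.AbsoluteAnabelian.AbsTopII.InertiaGroupsLogPoints
import Literature.AnabelianGeometry.AbsoluteAnabelian.FreeProcyclicStructure
import HarnessLib

/-!
# [AbsTopII] Prop 1.3 (x) (`Prop_1_3_x″`) NON-VACUOUSLY at the smooth-curve product model: the log points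

S. Mochizuki, *Topics in Absolute Anabelian Geometry II* [AbsTopII] (bib `MochizukiAbsTopII2013`; kurims
manuscript `paper:url-585b8d0ad0d9`), §1 Prop 1.3 (x) p. 12 («Let `τ_I : I → Π_I` be the [outer] homomorphism
that arises from a log point `τ_S ∈ X^log(S^log)` … if `τ_I` is non-verticial and non-edge-like, then the image
of `τ_S` is the unique cusp `e_τ` of `X` such that `τ_I(I) ⊆ D_{e_τ}` … `τ_I(I) = I_{v_τ}` iff the image of `τ_S` is a
non-nodal point of the irreducible component `v_τ` …»).  abc-iut-L4-t6 types (x) for a FAMILY of log points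
`pt : L → X.LogPointData` supplied by the model (`DPSCIndexData.Prop_1_3_x″`, v3, `InertiaGroupsLogPoints.lean`):
the universal closure over all labelled sections is refuted (`Prop13xLabelScope.lean`), and the only model in the
tree is `Π_H = 1` (`exists_prop_1_3_x'`, nothing exercised).

This PROOF-ONLY file (no definitions) supplies the log points of abc-iut-f-066's SMOOTH-CURVE PRODUCT MODEL
(`Prop13SmoothCurveModel.lean`: `Π_H = Q × Z ⊇ Π_𝔾 = Q × 1 = Π_v`, `Q` a profinite pro-`Σ` completion of a
hyperbolic `Γ_{g,r}`, `r ≥ 1` cusps `Π_{c_j} = closure ι₀⟨c_j⟩`, `Z = Ẑ^Σ`, `Π_I = Π_H`, `I_v = 1 × Z`; built with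
abc-iut-f-069's `DPSCIndexData.ofEmbedding`) as the family indexed by `Vert ⊕ Cusp` which the smooth log curve of
type `(g, r)` over the log point with trivial `Σ`-inertia action carries (honest label, model-side):
* a NON-CUSPIDAL point `x ∈ v`: `τ_I(I) = I_v` (the log structure at `x` is pulled back from the base), labelled
  «smooth point of `v`»;
* the CUSP `e`: `τ_I(I)` = the graph of an isomorphism `ψ_e : Z = Ẑ^Σ ≃ Π_e` inside `D_e ∩ Π_I = Π_e × I_v` (a log
  point AT the cusp sends the cusp generator of the log structure to the base generator — times a unit —, so its
  section is «diagonal» in `I_e × I_v ≅ Ẑ^Σ × Ẑ^Σ`; `ψ_e` from the structure theorem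
  `IsFreeProSigmaCyclic.exists_continuousMulEquiv_padicSigmaProd` and `Π_e ≅ Ẑ^Σ`, abc-iut-f-066's
  `isFreeProSigmaCyclic_cuspInertia_closure`), labelled «the cusp `e`».

`exists_logPoints_prop_1_3_x''_ofEmbedding_smoothCurve`: this family satisfies `Prop_1_3_x″` — with CLAUSE 1
ACTIVE at every cusp (the section is non-verticial AND non-edge-like, and `e` is the UNIQUE cusp with
`τ_I(I) ⊆ γ D_e γ⁻¹`: uniqueness = cusp-inertia disjointness `PSCDatum.smul_cuspGp_inf_smul_cuspGp_eq_bot` +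
`N_Q(Π_e) = Π_e` from commensurable terminality) and clause 2 active at the smooth points;
`exists_smoothCurve_model_prop_1_3_x''`: hence, for every nonempty set of primes `Σ` and hyperbolic `(g, r)`,
`r ≥ 1`, a `Σ`-indexed DPSC datum WITH CUSPS and a family of `|Vert| + r` log points satisfying `Prop_1_3_x″`
non-vacuously (together with the typed (i)–(vii), (ix) there, `exists_smoothCurve_model_prop13_all`).
Companion (L4-lead batch m21, the «(x″) split»): abc-iut-L4-t6's ABSTRACT closer
`exists_family_prop_1_3_x''_of_smoothCurveShape` (`InertiaGroupsLogPointsSmoothShape.lean`) derives such a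
family from named hypotheses on abstract one-vertex data; this file is the MODEL side (a direct proof at the
product model, independent of that closer).
HONEST FRAMING: abstract-group model; the family is the model's own datum, chosen to mirror the log points of a
smooth log curve (Riemann existence / log specialisation are not in the tree); consistency evidence for the v3
typing, not an endorsement; typed ≠ proved; no side taken on [IUTchIII] Cor 3.12.
-/

noncomputable section

open scoped Pointwise

namespace Literature.AnabelianGeometry.AbsoluteAnabelian

open Literature.AlgebraicGeometry.Frobenioids (IsSlimGroup)
open Literature.AnabelianGeometry.SemiGraphs
open Literature.AnabelianGeometry.SemiGraphs.SemiGraphOfAnabelioids (IsProSigmaCompletion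
  cuspInertia_closure_isCommensurablyTerminal)
open Literature.GroupTheory.CombinatorialGroupTheory
open Topology

namespace DPSCData

/-! ### One more generic lemma on `A × B` read through `inl` -/

section ProductHelpers

variable {A B : Type*} [Group A] [Group B]

/-- If `(a, b)` normalises `K × 1 ⊆ A × B`, then `a` normalises `K`. [cite: MochizukiAbsTopII2013, Def 1.2 (ii) p.10] -/
theorem fst_mem_normalizer_of_mem_normalizer_map_inl (K : Subgroup A) {p : A × B}
    (hp : p ∈ Subgroup.normalizer ((K.map (MonoidHom.inl A B) : Subgroup (A × B)) : Set (A × B))) :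
    p.1 ∈ Subgroup.normalizer (K : Set A) := by
  rw [Subgroup.mem_normalizer_iff] at hp ⊢
  intro a
  have key : ∀ a' : A, ((a', (1 : B)) ∈ (K.map (MonoidHom.inl A B) : Subgroup (A × B))) ↔ a' ∈ K := by
    intro a'
    simp only [Subgroup.mem_map, MonoidHom.inl_apply, Prod.mk.injEq, and_true, exists_eq_right]
  have h := hp (a, 1)
  rw [key] at h
  rw [h]
  have hconj : p * (a, 1) * p⁻¹ = (p.1 * a * p.1⁻¹, 1) := by ext <;> simp
  rw [hconj, key]

/-- `K × B` normalises `K × 1`. [cite: MochizukiAbsTopII2013, Def 1.2 (ii) p.10] -/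
theorem prod_top_le_normalizer_map_inl (K : Subgroup A) :
    K.prod (⊤ : Subgroup B) ≤
      Subgroup.normalizer ((K.map (MonoidHom.inl A B) : Subgroup (A × B)) : Set (A × B)) := by
  rintro ⟨k, b⟩ hkb
  have hk : k ∈ K := (Subgroup.mem_prod.mp hkb).1
  have key : ∀ (a' : A) (b' : B), ((a', b') ∈ (K.map (MonoidHom.inl A B) : Subgroup (A × B))) ↔
      a' ∈ K ∧ b' = 1 := by
    intro a' b'
    simp only [Subgroup.mem_map, MonoidHom.inl_apply, Prod.mk.injEq]
    constructor
    · rintro ⟨a, ha, rfl, rfl⟩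
      exact ⟨ha, rfl⟩
    · rintro ⟨ha, rfl⟩
      exact ⟨a', ha, rfl, rfl⟩
  rw [Subgroup.mem_normalizer_iff]
  rintro ⟨x, y⟩
  have hconj : ((k, b) * (x, y) * (k, b)⁻¹ : A × B) = (k * x * k⁻¹, b * y * b⁻¹) := by ext <;> simp
  rw [hconj, key, key]
  constructor
  · rintro ⟨hx, rfl⟩
    exact ⟨K.mul_mem (K.mul_mem hk hx) (K.inv_mem hk), by simp⟩
  · rintro ⟨hx, hy⟩
    refine ⟨?_, ?_⟩
    · have := K.mul_mem (K.mul_mem (K.inv_mem hk) hx) hk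
      simpa [mul_assoc] using this
    · simpa using hy

end ProductHelpers

end DPSCData

namespace AbsTopII.DPSCIndexData

variable {Q : Type} [Group Q] [TopologicalSpace Q] [IsTopologicalGroup Q] [CompactSpace Q] [T2Space Q]
  [TotallyDisconnectedSpace Q]
  {Z : Type} [Group Z] [TopologicalSpace Z] [IsTopologicalGroup Z] [CompactSpace Z] [T2Space Z]
  [TotallyDisconnectedSpace Z]
  (G : PSCDatum Q) (hιr : IsClosed ((MonoidHom.inl Q Z).range : Set (ProfiniteGrp.of (Q × Z))))
  (hιn : (MonoidHom.inl Q Z).range.Normal) (σ : G.graph.N → ℕ)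
  (hσ : ∀ e, Anabelioids.IsSigmaInteger G.Sigma (σ e)) {g r : ℕ}

/-- **The log points of the smooth-curve product model satisfy [AbsTopII] Prop 1.3 (x) (`Prop_1_3_x″`),
non-vacuously.**  For a PSC datum `G` of smooth-curve shape on a profinite pro-`Σ` completion `Q` of a hyperbolic
`Γ_{g,r}` (one vertex `Π_v = Q`, no nodes, cusps `Π_{c_j} = closure ι₀⟨c_j⟩`), a profinite free pro-`Σ`-cyclic `Z`,
and `X = DPSCIndexData.ofEmbedding G (Q × Z) inl … ⊤ …` (`Π_I = Π_H`): the family `pt : Vert ⊕ Cusp → LogPointData`,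
`pt v = (I_v, smooth v)`, `pt e = (graph of ψ_e : Z ≃ Π_e, cusp e)`, satisfies `X.Prop_1_3_x″ pt`; every cusp
member is non-verticial and non-edge-like (clause 1 exercised) with section inside `D_e ∩ Π_I`.
[cite: MochizukiAbsTopII2013, Prop 1.3 (x) p.12] -/
theorem exists_logPoints_prop_1_3_x''_ofEmbedding_smoothCurve [hN : IsEmpty G.graph.N]
    (hV : ∀ v, G.vertGp v = ⊤) (hV1 : ∀ v w : G.graph.V, v = w)
    (h : PuncturedSurfaceGroup.IsHyperbolicType g r) (ι₀ : PuncturedSurfaceGroup g r →* Q)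
    (hι₀ : IsProSigmaCompletion G.Sigma ι₀) (eC : G.graph.C ≃ Fin r)
    (hC : ∀ c, G.cuspGp c = ((PuncturedSurfaceGroup.cuspInertia (g := g) (eC c)).map ι₀).topologicalClosure)
    (hZ : IsFreeProSigmaCyclic G.Sigma Z) (X : DPSCIndexData.{0})
    (hX : X = DPSCIndexData.ofEmbedding G (ProfiniteGrp.of (Q × Z)) (MonoidHom.inl Q Z) hιr hιn ⊤
      inferInstance le_top σ hσ) :
    ∃ pt : X.Vert ⊕ X.Cusp → X.LogPointData,
      (∀ v, (pt (Sum.inl v)).kind = PointKind.smooth v ∧ (pt (Sum.inl v)).image = X.Iv v) ∧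
      (∀ c, (pt (Sum.inr c)).kind = PointKind.cusp c ∧ (pt (Sum.inr c)).IsNonVerticial ∧
        (pt (Sum.inr c)).IsNonEdgeLike ∧ (pt (Sum.inr c)).image ≤ X.DvCusp c ⊓ X.PiI) ∧
      X.Prop_1_3_x'' pt := by
  classical
  subst hX
  set E : ProfiniteGrp.{0} := ProfiniteGrp.of (Q × Z) with hE
  set X := DPSCIndexData.ofEmbedding G E (MonoidHom.inl Q Z) hιr hιn ⊤ inferInstance le_top σ hσ with hXdef
  have hne : G.Sigma.Nonempty := G.sigma_nonempty
  have hprime : ∀ p ∈ G.Sigma, p.Prime := G.sigma_prime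
  /- `Q` is slim, hence centre-free; `I_v = 1 × Z` -/
  have hslimQ : IsSlimGroup Q := proSigmaSurfaceGroupSlim_holds G.Sigma hne hprime g r h Q ι₀ hι₀
  have hZQ : Subgroup.center Q = ⊥ := by
    refine eq_bot_iff.mpr fun z hz => (hslimQ.centralizer_eq_bot ⊤ (by simp)).le ?_
    exact Subgroup.mem_centralizer_iff.mpr fun y _ => Subgroup.mem_center_iff.mp hz y
  have hPiG : X.PiG = (MonoidHom.inl Q Z).range := rfl
  have hvert : ∀ v : X.Vert, X.vertSub v = X.PiG := by
    intro v
    show (G.vertGp v.down).map (MonoidHom.inl Q Z) = (MonoidHom.inl Q Z).range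
    rw [hV, ← MonoidHom.range_eq_map]
  have hIv : ∀ v : X.Vert, X.Iv v = (⊥ : Subgroup Q).prod (⊤ : Subgroup Z) := by
    intro v
    show Subgroup.centralizer (X.vertSub v : Set X.PiH) ⊓ ⊤ = _
    rw [inf_top_eq, hvert v, hPiG]
    exact DPSCData.centralizer_range_inl_eq_bot_prod_top hZQ
  have hIvmem : ∀ (v : X.Vert) (x : X.PiH), x ∈ X.Iv v ↔ (x : Q × Z).1 = 1 := by
    intro v x
    rw [hIv v]
    exact ⟨fun hx => Subgroup.mem_bot.mp (Subgroup.mem_prod.mp hx).1,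
      fun hx => Subgroup.mem_prod.mpr ⟨Subgroup.mem_bot.mpr hx, Subgroup.mem_top _⟩⟩
  have hIvnormal : ∀ v : X.Vert, (X.Iv v).Normal := fun v => by
    rw [hIv v]; exact (inferInstance : ((⊥ : Subgroup Q).prod (⊤ : Subgroup Z)).Normal)
  have hIvcl : ∀ v : X.Vert, IsClosed (X.Iv v : Set X.PiH) := fun v => by
    show IsClosed (((Subgroup.centralizer (X.vertSub v : Set X.PiH) ⊓ ⊤ : Subgroup X.PiH)) : Set X.PiH)
    rw [inf_top_eq]
    exact Set.isClosed_centralizer _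
  have hIvG : ∀ v : X.Vert, X.Iv v ⊓ X.PiG = ⊥ := by
    refine fun v => eq_bot_iff.mpr ?_
    rintro x ⟨h1, ⟨a, rfl⟩⟩
    rw [Subgroup.mem_bot, show a = 1 from (hIvmem v _).mp h1, map_one]
    rfl
  have hIvsup : ∀ v : X.Vert, X.Iv v ⊔ X.PiG = X.PiI := by
    intro v
    show X.Iv v ⊔ X.PiG = ⊤
    rw [hIv v, hPiG]
    show ((⊥ : Subgroup Q).prod (⊤ : Subgroup Z)) ⊔ (MonoidHom.inl Q Z).range = (⊤ : Subgroup (Q × Z))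
    rw [eq_top_iff]
    rintro ⟨q, z⟩ -
    have hx : ((q, z) : Q × Z) = ((1 : Q), z) * (q, 1) := Prod.ext (by simp) (by simp)
    rw [hx]
    exact Subgroup.mul_mem _
      (Subgroup.mem_sup_left (Subgroup.mem_prod.mpr ⟨Subgroup.mem_bot.mpr rfl, Subgroup.mem_top _⟩))
      (Subgroup.mem_sup_right ⟨q, rfl⟩)
  /- the cusp groups `K c`: infinite, disjoint, normally terminal, free pro-`Σ`-cyclic -/
  have hKinf : ∀ c, Infinite ↥(G.cuspGp c) := fun c => G.infinite_cuspGp hne hprime h ι₀ hι₀ eC hC c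
  have hKN : ∀ c, Subgroup.normalizer (G.cuspGp c : Set Q) = G.cuspGp c := by
    intro c
    rw [hC c]
    exact (cuspInertia_closure_isCommensurablyTerminal hne hprime h ι₀ hι₀ (eC c)).isNormallyTerminal.normalizer_eq
  have hKdisj : ∀ {c₁ c₂ : G.graph.C}, c₁ ≠ c₂ → ∀ γ : ConjAct Q, G.cuspGp c₁ ⊓ γ • G.cuspGp c₂ = ⊥ := by
    intro c₁ c₂ hc γ
    have := G.smul_cuspGp_inf_smul_cuspGp_eq_bot hne hprime h ι₀ hι₀ eC hC hc 1 γ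
    rwa [one_smul] at this
  have hKcl : ∀ c, IsClosed (G.cuspGp c : Set Q) := G.isClosed_cuspGp
  have hψ : ∀ c, Nonempty (Z ≃ₜ* ↥(G.cuspGp c)) := by
    intro c
    haveI : CompactSpace ↥(G.cuspGp c) := isCompact_iff_compactSpace.mp (hKcl c).isCompact
    obtain ⟨eZ, -⟩ := hZ.exists_continuousMulEquiv_padicSigmaProd
    obtain ⟨eK, -⟩ := (G.isFreeProSigmaCyclic_cuspGp_of_smoothCurve h ι₀ hι₀ eC hC c)
      |>.exists_continuousMulEquiv_padicSigmaProd
    exact ⟨eZ.trans eK.symm⟩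
  let ψ : ∀ c, Z ≃ₜ* ↥(G.cuspGp c) := fun c => (hψ c).some
  -- the sections at the cusps: graphs of `φ c := ψ c : Z → Π_c ⊆ Q`
  let φ : ∀ c : G.graph.C, Z →* Q := fun c => (G.cuspGp c).subtype.comp (ψ c).toMonoidHom
  have hφmem : ∀ c z, φ c z ∈ G.cuspGp c := fun c z => ((ψ c) z).2
  have hφc : ∀ c, Continuous (φ c) := fun c => continuous_subtype_val.comp (ψ c).continuous
  have hφne : ∀ c (z : Z), z ≠ 1 → φ c z ≠ 1 := by
    intro c z hz h1
    apply hz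
    have : (ψ c) z = 1 := Subtype.ext h1
    simpa using this
  let T : ∀ c : G.graph.C, Subgroup (Q × Z) := fun c => ((φ c).prod (MonoidHom.id Z)).range
  have hTmem : ∀ c (x : Q × Z), x ∈ T c ↔ x.1 = φ c x.2 := by
    intro c x
    constructor
    · rintro ⟨z, rfl⟩
      rfl
    · intro hx
      exact ⟨x.2, Prod.ext hx.symm rfl⟩
  have hTcl : ∀ c, IsClosed (T c : Set (Q × Z)) := by
    intro c
    have hcont : Continuous ((φ c).prod (MonoidHom.id Z)) := (hφc c).prodMk continuous_id
    exact (isCompact_range hcont).isClosed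
  -- a nontrivial element of `Z`
  obtain ⟨p₀, hp₀⟩ := id hne
  haveI : Infinite Z := hZ.infinite (hprime p₀ hp₀) hp₀
  obtain ⟨z₀, hz₀⟩ : ∃ z : Z, z ≠ 1 := exists_ne 1
  /- the family of log points -/
  haveI : Subsingleton X.Vert := ⟨fun v w => by rw [← ULift.up_down v, ← ULift.up_down w, hV1 v.down w.down]⟩
  have hTinf : ∀ c : X.Cusp, (T c.down : Subgroup X.PiH) ⊓ X.PiG = ⊥ := by
    refine fun c => eq_bot_iff.mpr ?_
    rintro x ⟨hx, ⟨a, rfl⟩⟩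
    have h1 : (a : Q) = φ c.down 1 := (hTmem c.down _).mp hx
    rw [map_one] at h1
    rw [Subgroup.mem_bot, h1, map_one]
  have hTsup : ∀ c : X.Cusp, (T c.down : Subgroup X.PiH) ⊔ X.PiG = X.PiI := by
    intro c
    show (T c.down : Subgroup X.PiH) ⊔ X.PiG = ⊤
    rw [hPiG, eq_top_iff]
    rintro x -
    have hx : x = ((x : Q × Z).1 * (φ c.down (x : Q × Z).2)⁻¹, (1 : Z)) *
        (φ c.down (x : Q × Z).2, (x : Q × Z).2) := by
      show (x : Q × Z) = _
      exact Prod.ext (by simp) (by simp)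
    rw [hx]
    exact Subgroup.mul_mem _ (Subgroup.mem_sup_right ⟨_, rfl⟩)
      (Subgroup.mem_sup_left ((hTmem c.down _).mpr rfl))
  let ptV : X.Vert → X.LogPointData := fun v =>
    { image := X.Iv v, image_le := le_top, isClosed_image := hIvcl v, image_inf := hIvG v,
      image_sup := hIvsup v, kind := PointKind.smooth v }
  let ptC : X.Cusp → X.LogPointData := fun c =>
    { image := T c.down, image_le := le_top, isClosed_image := hTcl c.down, image_inf := hTinf c,
      image_sup := hTsup c, kind := PointKind.cusp c }
  let pt : X.Vert ⊕ X.Cusp → X.LogPointData := Sum.elim ptV ptC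
  have hpt_inr_image : ∀ c, (pt (Sum.inr c)).image = T c.down := fun _ => rfl
  /- the cusp members: non-verticial, non-edge-like, inside `D_c ∩ Π_I`, and `c` is the unique such cusp -/
  have hTle_D : ∀ c : X.Cusp, T c.down ≤ X.DvCusp c := by
    intro c
    refine le_trans ?_ (DPSCData.prod_top_le_normalizer_map_inl (G.cuspGp c.down))
    intro x hx
    exact Subgroup.mem_prod.mpr ⟨((hTmem _ _).mp hx).symm ▸ hφmem _ _, Subgroup.mem_top _⟩
  have hT_not_le_PiG : ∀ c : X.Cusp, ¬ T c.down ≤ X.PiG := by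
    intro c hle
    obtain ⟨a, ha⟩ := hle (((hTmem c.down (φ c.down z₀, z₀)).mpr rfl))
    exact hz₀ (congrArg Prod.snd ha).symm
  have hnonvert : ∀ c : X.Cusp, (pt (Sum.inr c)).IsNonVerticial := by
    intro c w g₀ hle
    rw [hpt_inr_image, ← toConjAct_smul_subgroup_eq, (hIvnormal w).conjAct] at hle
    have h1 := (hIvmem w _).mp (hle ((hTmem c.down (φ c.down z₀, z₀)).mpr rfl))
    exact hφne c.down z₀ hz₀ h1
  haveI : X.PiG.Normal := X.normal_PiG
  have hnonedge : ∀ c : X.Cusp, (pt (Sum.inr c)).IsNonEdgeLike := by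
    intro c e g₀ hle
    rcases e with n | c'
    · exact hN.false n.down
    · rw [hpt_inr_image] at hle
      exact hT_not_le_PiG c (hle.trans (mulAut_conj_smul_le_of_normal X.PiG (X.cuspSub_le c') g₀))
  have hunique : ∀ (c c' : X.Cusp) (γ : X.PiH), γ ∈ X.PiG →
      T c.down ≤ MulAut.conj γ • X.DvCusp c' → c' = c := by
    rintro c c' γ ⟨q, rfl⟩ hle
    by_contra hcc
    have hcc' : c.down ≠ c'.down := fun h' => hcc (ULift.ext _ _ h'.symm)
    -- every `φ c z` normalises `q Π_{c'} q⁻¹`, hence lies in it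
    have hsub : ∀ z : Z, φ c.down z ∈ (ConjAct.toConjAct q • G.cuspGp c'.down : Subgroup Q) := by
      intro z
      have hz := hle ((hTmem c.down (φ c.down z, z)).mpr rfl)
      -- `(q,1)⁻¹ (φ z, z) (q,1) ∈ D_{c'} = N(Π_{c'} × 1)`, so `q⁻¹ (φ z) q ∈ N(Π_{c'}) = Π_{c'}`
      have hz2 := (Subgroup.mem_pointwise_smul_iff_inv_smul_mem (G := X.PiH)).mp hz
      change _ ∈ Subgroup.normalizer
        (((G.cuspGp c'.down).map (MonoidHom.inl Q Z) : Subgroup (Q × Z)) : Set (Q × Z)) at hz2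
      have hz' := DPSCData.fst_mem_normalizer_of_mem_normalizer_map_inl (G.cuspGp c'.down) hz2
      rw [hKN] at hz'
      rw [Subgroup.mem_pointwise_smul_iff_inv_smul_mem, ← map_inv, ConjAct.smul_def,
        ConjAct.ofConjAct_toConjAct, inv_inv]
      exact hz'
    have hbot := hKdisj hcc' (ConjAct.toConjAct q)
    have hmem : φ c.down z₀ ∈ G.cuspGp c.down ⊓ ConjAct.toConjAct q • G.cuspGp c'.down :=
      ⟨hφmem _ _, hsub z₀⟩
    rw [hbot, Subgroup.mem_bot] at hmem
    exact hφne c.down z₀ hz₀ hmem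
  refine ⟨pt, fun v => ⟨rfl, rfl⟩, fun c => ⟨rfl, hnonvert c, hnonedge c, le_inf (hTle_D c) le_top⟩,
    fun l => ?_⟩
  rcases l with v | c
  · -- a smooth point of `v`: the section IS `I_v`
    refine ⟨fun hnv _ => (hnv v 1 ?_).elim, fun _ => ⟨fun w => ?_, fun n => (hN.false n.down).elim⟩⟩
    · rw [map_one, one_smul]
      exact le_rfl
    · rw [Subsingleton.elim w v]
      exact ⟨fun _ => rfl, fun _ => ⟨1, Subgroup.one_mem _, by rw [map_one, one_smul]; rfl⟩⟩
  · -- the cusp `c`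
    refine ⟨fun _ _ => ⟨c, rfl, fun c' => ⟨fun hex => ?_, fun hc' => ?_⟩⟩, fun hk => (hk c rfl).elim⟩
    · obtain ⟨γ, hγ, hle⟩ := hex
      exact hunique c c' γ hγ hle
    · rw [hc']
      exact ⟨1, Subgroup.one_mem _, by rw [map_one, one_smul]; exact hTle_D c⟩

/-- **A `Σ`-indexed DPSC datum WITH CUSPS and a family of log points satisfying the typed [AbsTopII]
Prop 1.3 (x) (`Prop_1_3_x″`) NON-VACUOUSLY — together with the typed (i), (ii), (iii), (iii′), (iv′), (v),
(v′), (vi), (vii), (ix)** at the same datum (abc-iut-f-066's smooth-curve product model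
`exists_smoothCurve_product_model`, re-entered; (i) by abc-iut-f-069's `prop_1_3_i_ofEmbedding` ∘
`isFreeProSigmaCyclic_cuspGp_of_smoothCurve`): for every nonempty set of primes `Σ` and every hyperbolic
`(g, r)` with `r ≥ 1`.  Every cusp member of the family is non-verticial and non-edge-like (clause 1 of (x)
exercised), every smooth member has section `I_v` (clause 2 exercised).  Abstract-group model; constructed ≠
geometric. [cite: MochizukiAbsTopII2013, Prop 1.3 pp.11-12] -/
theorem exists_smoothCurve_model_prop_1_3_x'' (Sigma : Set ℕ) (hS₁ : Sigma.Nonempty)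
    (hS₂ : ∀ p ∈ Sigma, p.Prime) (g r : ℕ) (hgr : PuncturedSurfaceGroup.IsHyperbolicType g r)
    (hr : 0 < r) :
    ∃ (X : DPSCIndexData.{0}) (pt : X.Vert ⊕ X.Cusp → X.LogPointData),
      X.Sigma = Sigma ∧ Nonempty (X.Cusp ≃ Fin r) ∧ IsEmpty X.Node ∧ Nonempty X.Vert ∧
      (∀ v, (pt (Sum.inl v)).kind = PointKind.smooth v ∧ (pt (Sum.inl v)).image = X.Iv v) ∧
      (∀ c, (pt (Sum.inr c)).kind = PointKind.cusp c ∧ (pt (Sum.inr c)).IsNonVerticial ∧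
        (pt (Sum.inr c)).IsNonEdgeLike ∧ (pt (Sum.inr c)).image ≤ X.DvCusp c ⊓ X.PiI) ∧
      X.Prop_1_3_x'' pt ∧
      X.Prop_1_3_i ∧ X.Prop_1_3_ii ∧ X.Prop_1_3_iii' ∧ X.toDPSCData.Prop13iii ∧ X.toDPSCData.Prop13iv' ∧
      X.toDPSCData.Prop13v ∧ X.Prop_1_3_v' ∧ X.toDPSCData.Prop13vi ∧ X.toDPSCData.Prop13vii ∧
      X.toDPSCData.Prop13ix := by
  obtain ⟨Q, ι₀, hι₀, Z, hZ, G, hιr, hιn, X, -, -, hGS, hN, -, hV1, hVtop, ⟨e, hC⟩, -, -, -, -, hX, hXS, -,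
    hCusp, hNode, hVert, -, -, -, -, -, -, -, -, -, -, -, -, -, -, -, -, -, -, -, -, -, -, -, hii, hiii',
    hiii, hiv', hv, hv', hvi, hvii, hix⟩ :=
    exists_smoothCurve_product_model Sigma hS₁ hS₂ g r hgr hr
  haveI := hN
  obtain ⟨X₀, S, hS, τ, hτ⟩ := X
  cases hX
  obtain rfl : S = G.Sigma := hXS.trans hGS.symm
  have hι₀' : IsProSigmaCompletion G.Sigma ι₀ := hGS ▸ hι₀
  have hZ' : IsFreeProSigmaCyclic G.Sigma Z := hGS ▸ hZ
  have hXeq : (⟨DPSCData.ofEmbedding G (ProfiniteGrp.of (Q × Z)) (MonoidHom.inl Q Z) hιr hιn ⊤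
      inferInstance le_top, G.Sigma, hS, τ, hτ⟩ : DPSCIndexData.{0}) =
      DPSCIndexData.ofEmbedding G (ProfiniteGrp.of (Q × Z)) (MonoidHom.inl Q Z) hιr hιn ⊤ inferInstance
        le_top (fun n => τ ⟨n⟩) (fun n => hτ ⟨n⟩) := rfl
  obtain ⟨pt, hptV, hptC, hx⟩ := exists_logPoints_prop_1_3_x''_ofEmbedding_smoothCurve G hιr hιn
    (fun n => τ ⟨n⟩) (fun n => hτ ⟨n⟩) hVtop hV1 hgr ι₀ hι₀' e hC hZ' _ hXeq
  have hi : DPSCIndexData.Prop_1_3_i ⟨DPSCData.ofEmbedding G (ProfiniteGrp.of (Q × Z)) (MonoidHom.inl Q Z)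
      hιr hιn ⊤ inferInstance le_top, G.Sigma, hS, τ, hτ⟩ := by
    rw [hXeq]
    exact prop_1_3_i_ofEmbedding G (ProfiniteGrp.of (Q × Z)) (MonoidHom.inl Q Z)
      (continuous_id.prodMk continuous_const) (fun a b hab => (Prod.ext_iff.mp hab).1) hιr hιn ⊤
      inferInstance le_top (fun n => τ ⟨n⟩) (fun n => hτ ⟨n⟩)
      (G.isFreeProSigmaCyclic_cuspGp_of_smoothCurve hgr ι₀ hι₀' e hC)
  exact ⟨_, pt, hXS, hCusp, hNode, hVert, hptV, hptC, hx, hi, hii, hiii', hiii, hiv', hv, hv', hvi, hvii,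
    hix⟩

end AbsTopII.DPSCIndexData

end Literature.AnabelianGeometry.AbsoluteAnabelian

end
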